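import Summits.HodgeConjecture.HodgeConjecture.Theorems.SignSymmetricPowersNodalFormsTools

/-!
# K1-B nodal forms (route `SignSymmetricPowers`, item stmt-HodgeConjecture-19716) — the exchanged pair, I

Helper file for the registered stub `stub_signNodalForms` (K1-B line `andre-zariski` v9/v10, WANTED
P3-W8; third conjunct): for every even `d = 2n + 4 ≥ 4` an ι-even quinary form of degree `d` whose
projective hypersurface is singular exactly at the ι-exchanged pair `p± = [±1:0:1:0:0]`, both ordinary double
points. This part: the gradient in closed form, its vanishing at `p±`, the two Hessians and their rank
`4`, and `p₊ ∦ p₋` — for ARBITRARY transversal coefficients `c₁, c₄`. Part II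
(`SignSymmetricPowersNodalFormPair.lean`) fixes `c₁, c₄` and proves that there is no other singular point.
Landed `--supports stmt-HodgeConjecture-19716` as a helper. Sorry-free; axioms standard.

## The witness (blueprint `memos/K1B-NODAL-FORMS-g22.md` §(pair), with a split transversal part)

`f = (x₀² - x₂²)² (x₀^{2n} + x₂^{2n}) + x₂^{2n+2} (x₁² + x₃x₄) + c₁ x₁^{2n+4} + x₃^{2n+4} + c₄ x₄^{2n+4}`.

* base part `h = φ² g`, `φ = x₀² - x₂²`, `g = x₀^{2n} + x₂^{2n}` (double roots of `h(·, 1)` exactly at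
  `x₀ = ±1`; `g(±1, 1) = 2`, `g(1, 0) ≠ 0`);
* gradient (`pderiv_pairForm`): `∂₀f = 4x₀φg + 2n φ² x₀^{2n-1}`, `∂₁f = 2x₂^{2n+2}x₁ + (2n+4)c₁x₁^{2n+3}`,
  `∂₂f = -4x₂φg + 2nφ²x₂^{2n-1} + (2n+2)x₂^{2n+1}(x₁² + x₃x₄)`, `∂₃f = x₂^{2n+2}x₄ + (2n+4)x₃^{2n+3}`,
  `∂₄f = x₂^{2n+2}x₃ + (2n+4)c₄x₄^{2n+3}`; all vanish at `p±` (`φ(p±) = 0`);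
* Hessians at `p±`: base block `2g ∇φ ∇φᵀ = [[16, ∓16], [∓16, 16]]`, transversal block
  `diag(2, [x₃ ↔ x₄])`; rank `4` (`rank_eq_four` with explicit row/column operations, kernel `∋ p±`).
-/

set_option linter.dupNamespace false

noncomputable section

namespace Summit.HodgeConjecture.HodgeConjecture.Theorems.SignSymmetricPowersNodalFormPairHessian

open MvPolynomial Literature.AlgebraicGeometry.Motives Literature.AlgebraicGeometry.HodgeTheory
open Summit.HodgeConjecture.HodgeConjecture.Theorems.SignSymmetricPowersNodalFormsTools

/-- The gradient of the pair-witness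
`(x₀² - x₂²)² (x₀^{2n} + x₂^{2n}) + x₂^{2n+2} (x₁² + x₃x₄) + c₁ x₁^{2n+4} + x₃^{2n+4} + c₄ x₄^{2n+4}`
(closed form of the five partial derivatives, for arbitrary coefficients `c₁, c₄`). -/
theorem pderiv_pairForm (n : ℕ) (c₁ c₄ : ℂ) :
    let f : MvPolynomial (Fin 5) ℂ := (X 0 ^ 2 - X 2 ^ 2) ^ 2 * (X 0 ^ (2 * n) + X 2 ^ (2 * n)) +
      X 2 ^ (2 * n + 2) * (X 1 ^ 2 + X 3 * X 4) + C c₁ * X 1 ^ (2 * n + 4) + X 3 ^ (2 * n + 4) +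
      C c₄ * X 4 ^ (2 * n + 4)
    pderiv 0 f = C 4 * X 0 * (X 0 ^ 2 - X 2 ^ 2) * (X 0 ^ (2 * n) + X 2 ^ (2 * n)) +
      C (2 * (n : ℂ)) * (X 0 ^ 2 - X 2 ^ 2) ^ 2 * X 0 ^ (2 * n - 1) ∧
    pderiv 1 f = C 2 * X 2 ^ (2 * n + 2) * X 1 + C (c₁ * (2 * (n : ℂ) + 4)) * X 1 ^ (2 * n + 3) ∧
    pderiv 2 f = -(C 4 * X 2 * (X 0 ^ 2 - X 2 ^ 2) * (X 0 ^ (2 * n) + X 2 ^ (2 * n))) +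
      C (2 * (n : ℂ)) * (X 0 ^ 2 - X 2 ^ 2) ^ 2 * X 2 ^ (2 * n - 1) +
      C (2 * (n : ℂ) + 2) * X 2 ^ (2 * n + 1) * (X 1 ^ 2 + X 3 * X 4) ∧
    pderiv 3 f = X 2 ^ (2 * n + 2) * X 4 + C (2 * (n : ℂ) + 4) * X 3 ^ (2 * n + 3) ∧
    pderiv 4 f = X 2 ^ (2 * n + 2) * X 3 + C (c₄ * (2 * (n : ℂ) + 4)) * X 4 ^ (2 * n + 3) := by
  intro f
  refine ⟨?_, ?_, ?_, ?_, ?_⟩ <;>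
  · simp +decide only [f, map_add, map_sub, Derivation.leibniz, Derivation.leibniz_pow, pderiv_X, pderiv_C,
      Pi.single_apply, smul_eq_mul, mul_zero, add_zero, sub_zero, Nat.add_succ_sub_one, if_true, if_false,
      nsmul_eq_mul, Nat.cast_add, Nat.cast_mul, Nat.cast_ofNat, mul_one]
    simp only [map_add, map_mul, map_natCast, map_ofNat]
    ring

/-- The gradient of the pair-witness as a vector of closed forms. -/
theorem pderiv_pairForm_eq (n : ℕ) (c₁ c₄ : ℂ) (j : Fin 5) :
    pderiv j ((X 0 ^ 2 - X 2 ^ 2) ^ 2 * (X 0 ^ (2 * n) + X 2 ^ (2 * n)) +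
        X 2 ^ (2 * n + 2) * (X 1 ^ 2 + X 3 * X 4) + C c₁ * X 1 ^ (2 * n + 4) + X 3 ^ (2 * n + 4) +
        C c₄ * X 4 ^ (2 * n + 4) : MvPolynomial (Fin 5) ℂ) =
      (![C 4 * X 0 * (X 0 ^ 2 - X 2 ^ 2) * (X 0 ^ (2 * n) + X 2 ^ (2 * n)) +
            C (2 * (n : ℂ)) * (X 0 ^ 2 - X 2 ^ 2) ^ 2 * X 0 ^ (2 * n - 1),
          C 2 * X 2 ^ (2 * n + 2) * X 1 + C (c₁ * (2 * (n : ℂ) + 4)) * X 1 ^ (2 * n + 3),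
          -(C 4 * X 2 * (X 0 ^ 2 - X 2 ^ 2) * (X 0 ^ (2 * n) + X 2 ^ (2 * n))) +
            C (2 * (n : ℂ)) * (X 0 ^ 2 - X 2 ^ 2) ^ 2 * X 2 ^ (2 * n - 1) +
            C (2 * (n : ℂ) + 2) * X 2 ^ (2 * n + 1) * (X 1 ^ 2 + X 3 * X 4),
          X 2 ^ (2 * n + 2) * X 4 + C (2 * (n : ℂ) + 4) * X 3 ^ (2 * n + 3),
          X 2 ^ (2 * n + 2) * X 3 + C (c₄ * (2 * (n : ℂ) + 4)) * X 4 ^ (2 * n + 3)] : Fin 5 → MvPolynomial (Fin 5) ℂ) j := by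
  obtain ⟨h0, h1, h2, h3, h4⟩ := pderiv_pairForm n c₁ c₄
  fin_cases j
  exacts [h0, h1, h2, h3, h4]

/-- The gradient of the pair-witness vanishes at `p₊ = (1,0,1,0,0)` and at `p₋ = (-1,0,1,0,0)`. -/
theorem eval_pderiv_pairForm_eq_zero (n : ℕ) (c₁ c₄ : ℂ) (j : Fin 5) :
    eval (![1, 0, 1, 0, 0] : Fin 5 → ℂ) (pderiv j ((X 0 ^ 2 - X 2 ^ 2) ^ 2 * (X 0 ^ (2 * n) + X 2 ^ (2 * n)) +
        X 2 ^ (2 * n + 2) * (X 1 ^ 2 + X 3 * X 4) + C c₁ * X 1 ^ (2 * n + 4) + X 3 ^ (2 * n + 4) +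
        C c₄ * X 4 ^ (2 * n + 4) : MvPolynomial (Fin 5) ℂ)) = 0 ∧
    eval (![-1, 0, 1, 0, 0] : Fin 5 → ℂ) (pderiv j ((X 0 ^ 2 - X 2 ^ 2) ^ 2 * (X 0 ^ (2 * n) + X 2 ^ (2 * n)) +
        X 2 ^ (2 * n + 2) * (X 1 ^ 2 + X 3 * X 4) + C c₁ * X 1 ^ (2 * n + 4) + X 3 ^ (2 * n + 4) +
        C c₄ * X 4 ^ (2 * n + 4) : MvPolynomial (Fin 5) ℂ)) = 0 := by
  rw [pderiv_pairForm_eq n c₁ c₄ j]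
  fin_cases j <;> simp

set_option maxHeartbeats 400000 in
/-- The Hessian of the pair-witness at `p₊ = (1,0,1,0,0)` has rank `4`. -/
theorem rank_hessian_pairForm_pos (n : ℕ) (c₁ c₄ : ℂ) :
    (Matrix.of fun i j : Fin 5 => eval (![1, 0, 1, 0, 0] : Fin 5 → ℂ)
      (pderiv i (pderiv j ((X 0 ^ 2 - X 2 ^ 2) ^ 2 * (X 0 ^ (2 * n) + X 2 ^ (2 * n)) +
        X 2 ^ (2 * n + 2) * (X 1 ^ 2 + X 3 * X 4) + C c₁ * X 1 ^ (2 * n + 4) + X 3 ^ (2 * n + 4) +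
        C c₄ * X 4 ^ (2 * n + 4) : MvPolynomial (Fin 5) ℂ)))).rank = 4 := by
  have hM : (Matrix.of fun i j : Fin 5 => eval (![1, 0, 1, 0, 0] : Fin 5 → ℂ)
      (pderiv i (pderiv j ((X 0 ^ 2 - X 2 ^ 2) ^ 2 * (X 0 ^ (2 * n) + X 2 ^ (2 * n)) +
        X 2 ^ (2 * n + 2) * (X 1 ^ 2 + X 3 * X 4) + C c₁ * X 1 ^ (2 * n + 4) + X 3 ^ (2 * n + 4) +
        C c₄ * X 4 ^ (2 * n + 4) : MvPolynomial (Fin 5) ℂ)))) =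
      !![16, 0, -16, 0, 0; 0, 2, 0, 0, 0; -16, 0, 16, 0, 0; 0, 0, 0, 0, 1; 0, 0, 0, 1, 0] := by
    ext i j
    rw [Matrix.of_apply, pderiv_pairForm_eq n c₁ c₄ j]
    fin_cases i <;> fin_cases j <;>
      simp [Derivation.leibniz, Derivation.leibniz_pow, pderiv_X, map_sub] <;> norm_num
  rw [hM]
  refine rank_eq_four (v := ![1, 0, 1, 0, 0])
    (A := !![1, 0, 0, 0, 0; 0, 1, 0, 0, 0; 0, 0, 0, 0, 0; 0, 0, 0, 0, 1; 0, 0, 0, 1, 0])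
    (B := !![1, 0, 1, 0, 0; 0, 1, 0, 0, 0; 0, 0, 1, 0, 0; 0, 0, 0, 1, 0; 0, 0, 0, 0, 1])
    (w := ![16, 2, 0, 1, 1]) (fun h => by simpa using congr_fun h 0) ?_ ?_ 2 ?_
  · ext i; fin_cases i <;> simp [Matrix.mulVec, dotProduct, Fin.sum_univ_five]
  · ext i j
    fin_cases i <;> fin_cases j <;> simp [Matrix.mul_apply, Fin.sum_univ_five]
  · intro i; fin_cases i <;> simp

set_option maxHeartbeats 400000 in
/-- The Hessian of the pair-witness at `p₋ = (-1,0,1,0,0)` has rank `4`. -/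
theorem rank_hessian_pairForm_neg (n : ℕ) (c₁ c₄ : ℂ) :
    (Matrix.of fun i j : Fin 5 => eval (![-1, 0, 1, 0, 0] : Fin 5 → ℂ)
      (pderiv i (pderiv j ((X 0 ^ 2 - X 2 ^ 2) ^ 2 * (X 0 ^ (2 * n) + X 2 ^ (2 * n)) +
        X 2 ^ (2 * n + 2) * (X 1 ^ 2 + X 3 * X 4) + C c₁ * X 1 ^ (2 * n + 4) + X 3 ^ (2 * n + 4) +
        C c₄ * X 4 ^ (2 * n + 4) : MvPolynomial (Fin 5) ℂ)))).rank = 4 := by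
  have hM : (Matrix.of fun i j : Fin 5 => eval (![-1, 0, 1, 0, 0] : Fin 5 → ℂ)
      (pderiv i (pderiv j ((X 0 ^ 2 - X 2 ^ 2) ^ 2 * (X 0 ^ (2 * n) + X 2 ^ (2 * n)) +
        X 2 ^ (2 * n + 2) * (X 1 ^ 2 + X 3 * X 4) + C c₁ * X 1 ^ (2 * n + 4) + X 3 ^ (2 * n + 4) +
        C c₄ * X 4 ^ (2 * n + 4) : MvPolynomial (Fin 5) ℂ)))) =
      !![16, 0, 16, 0, 0; 0, 2, 0, 0, 0; 16, 0, 16, 0, 0; 0, 0, 0, 0, 1; 0, 0, 0, 1, 0] := by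
    ext i j
    rw [Matrix.of_apply, pderiv_pairForm_eq n c₁ c₄ j]
    fin_cases i <;> fin_cases j <;>
      simp [Derivation.leibniz, Derivation.leibniz_pow, pderiv_X, map_sub, pow_mul] <;> norm_num
  rw [hM]
  refine rank_eq_four (v := ![-1, 0, 1, 0, 0])
    (A := !![1, 0, 0, 0, 0; 0, 1, 0, 0, 0; 0, 0, 0, 0, 0; 0, 0, 0, 0, 1; 0, 0, 0, 1, 0])
    (B := !![1, 0, -1, 0, 0; 0, 1, 0, 0, 0; 0, 0, 1, 0, 0; 0, 0, 0, 1, 0; 0, 0, 0, 0, 1])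
    (w := ![16, 2, 0, 1, 1]) (fun h => by simpa using congr_fun h 0) ?_ ?_ 2 ?_
  · ext i; fin_cases i <;> simp [Matrix.mulVec, dotProduct, Fin.sum_univ_five]
  · ext i j
    fin_cases i <;> fin_cases j <;> simp [Matrix.mul_apply, Fin.sum_univ_five]
  · intro i; fin_cases i <;> simp

/-- **The two nodes**: `p₊` and `p₋` are ordinary double points of the pair-witness, and they are not
proportional. -/
theorem isOrdinaryDoublePointOf_pairForm (n : ℕ) (c₁ c₄ : ℂ) :
    (∀ i, IsOrdinaryDoublePointOf ((X 0 ^ 2 - X 2 ^ 2) ^ 2 * (X 0 ^ (2 * n) + X 2 ^ (2 * n)) +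
        X 2 ^ (2 * n + 2) * (X 1 ^ 2 + X 3 * X 4) + C c₁ * X 1 ^ (2 * n + 4) + X 3 ^ (2 * n + 4) +
        C c₄ * X 4 ^ (2 * n + 4) : MvPolynomial (Fin 5) ℂ)
      ((![![1, 0, 1, 0, 0], ![-1, 0, 1, 0, 0]] : Fin 2 → Fin 5 → ℂ) i)) ∧
    ∀ i i' : Fin 2, (∃ t : ℂ, (![![1, 0, 1, 0, 0], ![-1, 0, 1, 0, 0]] : Fin 2 → Fin 5 → ℂ) i =
      t • (![![1, 0, 1, 0, 0], ![-1, 0, 1, 0, 0]] : Fin 2 → Fin 5 → ℂ) i') → i = i' := by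
  refine ⟨fun i => ?_, fun i i' ht => ?_⟩
  · fin_cases i
    · exact ⟨fun h => by simpa using congr_fun h 0, fun j => (eval_pderiv_pairForm_eq_zero n c₁ c₄ j).1,
        rank_hessian_pairForm_pos n c₁ c₄⟩
    · exact ⟨fun h => by simpa using congr_fun h 0, fun j => (eval_pderiv_pairForm_eq_zero n c₁ c₄ j).2,
        rank_hessian_pairForm_neg n c₁ c₄⟩
  · obtain ⟨t, ht⟩ := ht
    fin_cases i <;> fin_cases i'
    · rfl
    · exfalso
      have h0 := congr_fun ht 0
      have h2 := congr_fun ht 2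
      simp at h0 h2
      rw [← h2] at h0
      norm_num at h0
    · exfalso
      have h0 := congr_fun ht 0
      have h2 := congr_fun ht 2
      simp at h0 h2
      rw [← h2] at h0
      norm_num at h0
    · rfl

end Summit.HodgeConjecture.HodgeConjecture.Theorems.SignSymmetricPowersNodalFormPairHessian

end
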